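import Summits.Ventures.QEC.Census.RefinedPairCertificateSound
import Summits.Ventures.QEC.Census.RefinedLPBoundQuadratic
import HarnessLib

/-!
# Pair certificates with GAP SPLITS from subgroup orders and the quadratic parity count: checker, soundness, assembly

Venture QEC (cell `qec`, LADDER-QEC rung X1; row 06). `RefinedLPBoundQuadratic.lean` strengthens CRSS's
refined LP of the pair `(C, C′)` [CalderbankEtAl1998, §7 (ii)] by three non-linear facts PROVED for every additive
code: `K = Σ_{a,b} R(a,b,0)` and `K′ = Σ_b R′(0,b,0)` are powers of two (subgroup orders), and
`Z = Σ_{a even} R(a,b,c)` has `(2Z − 2^{n−k})² ∈ {0} ∪ {2^j}` [MacWilliamsSloane1977, Ch. 15 §2 Thm. 5]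
(`CRSSRefinedQuadFeasible`). This file is OUR side: branch-and-bound certificates whose internal nodes are, besides the
integer splits of `RTreeP`, **gap splits** `form ≤ v ∨ form ≥ v′` on one of the three forms, admissible when NO value
allowed by the corresponding fact lies strictly between `v` and `v′` — a side condition decided in the kernel
(`pow2GapOK`: no power of two in the gap; `quadGapOK`: no `z` in the gap with `(2z − 2^{n−k})²` zero or a power of
two). Both sides of a gap split are ordinary path rows (`RSplit`), so the leaves are the pair leaves `RLeafP` checked
by `rleafOKP` verbatim. Contents: `RTreeQ`, `checkPathQ` / `checkQ`, soundness `not_leafHypQ_of_checkPathQ`,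
`not_crssRefinedQuadFeasible_of_checkQ`, and the two-stage assembly `no_additiveCode_of_quadCerts`.
HONEST FRAMING: nonexistence only; nothing here certifies a distance; per-cell certificates are DATA files
`Census/IPBounds/…`. [cite: CalderbankEtAl1998, §7 (ii)–(iii) (printed p. 28)]; [cite: MacWilliamsSloane1977,
Ch. 15 §2 and Ch. 17 §4 Thm. 20].
-/

namespace Summit.Ventures.QEC.Census

open Finset Literature.InformationTheory.QuantumCodes

/-! ### 1. The three forms as coefficient tables, the side conditions, the trees -/

/-- Indicator table of the classes with `c = 0` (the form `K = Σ_{a,b} R(a,b,0)`). Column: definition (ours). [folklore] -/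
def tabKC (m w₀ : ℕ) : List (List (List ℤ)) := tab3 m w₀ fun _ _ c => if c = 0 then 1 else 0

/-- Indicator table of the classes with `a = 0 ∧ c = 0` (the form `K′ = Σ_b R′(0,b,0)`). Column: definition (ours). [folklore] -/
def tabKD (m w₀ : ℕ) : List (List (List ℤ)) := tab3 m w₀ fun a _ c => if a = 0 ∧ c = 0 then 1 else 0

/-- Indicator table of the classes with `a` even (the form `Z = Σ_{a even} R(a,b,c)`). Column: definition (ours). [folklore] -/
def tabZ (m w₀ : ℕ) : List (List (List ℤ)) := tab3 m w₀ fun a _ _ => if Even a then 1 else 0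

/-- **No power of two strictly inside the gap `(v, v′)`**: `2^j ≤ v ∨ v′ ≤ 2^j` for `j < J`, and `v′ ≤ 2^J`
(so every `2^j`, `j ≥ J`, is `≥ v′`). Column: definition (ours). [folklore] -/
def pow2GapOK (J : ℕ) (v v' : ℤ) : Bool :=
  ((List.range J).all fun j => decide ((2 : ℤ) ^ j ≤ v ∨ v' ≤ (2 : ℤ) ^ j)) && decide (v' ≤ (2 : ℤ) ^ J)

/-- **No admissible quadratic count strictly inside the gap `(v, v′)`**: for every integer `z` with `v < z < v′`,
`q = (2z − 2^N)²` is nonzero, `< 2^J`, and differs from `2^j` for `j < J`. Column: definition (ours).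
[cite: MacWilliamsSloane1977, Ch. 15 §2 Thm. 5] -/
def quadGapOK (N J : ℕ) (v v' : ℤ) : Bool :=
  (List.range (v' - v - 1).toNat).all fun t =>
    decide ((2 * (v + 1 + (t : ℤ)) - 2 ^ N) ^ 2 ≠ 0) && decide ((2 * (v + 1 + (t : ℤ)) - 2 ^ N) ^ 2 < (2 : ℤ) ^ J) &&
      (List.range J).all fun j => decide ((2 * (v + 1 + (t : ℤ)) - 2 ^ N) ^ 2 ≠ (2 : ℤ) ^ j)

/-- A **quad certificate**: pair leaves under integer splits and gap splits on `K` (`gapKC`), `K′` (`gapKD`), `Z`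
(`gapZ`); a gap node carries the exponent bound `J` of its side condition and the gap `(v, v′)`.
Column: definition (ours). [cite: MacWilliamsSloane1977, Ch. 17 §4 Thm. 20] -/
inductive RTreeQ where
  /-- a pair leaf -/
  | leaf (L : RLeafP) : RTreeQ
  /-- integer split `form ≤ v ∨ form ≥ v + 1` -/
  | split (ca cb cw : List ℤ) (cr crp : List (List (List ℤ))) (v : ℤ) (le ge : RTreeQ) : RTreeQ
  /-- gap split on `K = Σ_{a,b} R(a,b,0)` (a power of two): `K ≤ v ∨ K ≥ v′` -/
  | gapKC (J : ℕ) (v v' : ℤ) (le ge : RTreeQ) : RTreeQ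
  /-- gap split on `K′ = Σ_b R′(0,b,0)` (a power of two) -/
  | gapKD (J : ℕ) (v v' : ℤ) (le ge : RTreeQ) : RTreeQ
  /-- gap split on `Z = Σ_{a even} R(a,b,c)` (a quadratic zero count) -/
  | gapZ (J : ℕ) (v v' : ℤ) (le ge : RTreeQ) : RTreeQ

section Check

variable (n k d e w₀ : ℕ)

/-- The quad tree checker: leaves by `rleafOKP`; integer splits as in `RTreeP`; a gap split checks its side condition
and appends the path rows `form ≤ v` (left) and `form ≥ v′` (right). Column: definition (ours).
[cite: MacWilliamsSloane1977, Ch. 17 §4 Thm. 20] -/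
def RTreeQ.checkPathQ : RTreeQ → List RSplit → Bool
  | .leaf L, path => rleafOKP n k d e w₀ path L
  | .split ca cb cw cr crp v le ge, path =>
    le.checkPathQ (path ++ [⟨ca, cb, cw, cr, crp, v, false⟩]) && ge.checkPathQ (path ++ [⟨ca, cb, cw, cr, crp, v, true⟩])
  | .gapKC J v v' le ge, path =>
    pow2GapOK J v v' &&
      (le.checkPathQ (path ++ [⟨[], [], [], tabKC (n - w₀) w₀, [], v, false⟩]) &&
        ge.checkPathQ (path ++ [⟨[], [], [], tabKC (n - w₀) w₀, [], v' - 1, true⟩]))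
  | .gapKD J v v' le ge, path =>
    pow2GapOK J v v' &&
      (le.checkPathQ (path ++ [⟨[], [], [], [], tabKD (n - w₀) w₀, v, false⟩]) &&
        ge.checkPathQ (path ++ [⟨[], [], [], [], tabKD (n - w₀) w₀, v' - 1, true⟩]))
  | .gapZ J v v' le ge, path =>
    quadGapOK (n - k) J v v' &&
      (le.checkPathQ (path ++ [⟨[], [], [], tabZ (n - w₀) w₀, [], v, false⟩]) &&
        ge.checkPathQ (path ++ [⟨[], [], [], tabZ (n - w₀) w₀, [], v' - 1, true⟩]))

/-- The quad checker for `CRSSRefinedQuadFeasible n k d w₀` in parity branch `e`. Column: definition (ours).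
[cite: CalderbankEtAl1998, §7 (ii)] -/
def RTreeQ.checkQ (t : RTreeQ) : Bool := t.checkPathQ n k d e w₀ []

end Check

/-! ### 2. Soundness -/

section Soundness

variable {n k d e w₀ : ℕ} {A B W : ℕ → ℕ} {R Rp Rpp : ℕ → ℕ → ℕ → ℕ}

/-- All clauses used by a quad certificate: the pair hypotheses plus the three facts.
[cite: CalderbankEtAl1998, §7 (ii); MacWilliamsSloane1977, Ch. 15 §2 Thm. 5] -/
structure LeafHypQ (n k d e w₀ : ℕ) (path : List RSplit) (A B W : ℕ → ℕ) (R Rp Rpp : ℕ → ℕ → ℕ → ℕ) : Prop where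
  /-- the plain integer system -/
  sys : CRSSIntSystem n k d A B W e
  /-- the refined system of `(C, C⊥)` -/
  ref : CRSSRefinedSystem n k d w₀ A B R Rp
  /-- the refined system of `(C′, (C′)⊥)` -/
  ref2 : CRSSRefinedSystem n (k + e) 1 w₀ (evenPart A) W (evenPart₃ R) Rpp
  /-- the link `C⊥ ⊆ (C′)⊥` -/
  link : ∀ a b c, Rp a b c ≤ Rpp a b c
  /-- `K` is a power of two -/
  kc : ∃ j : ℕ, ∑ a ∈ range (n - w₀ + 1), ∑ b ∈ range (w₀ + 1), R a b 0 = 2 ^ j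
  /-- `K′` is a power of two -/
  kd : ∃ j : ℕ, ∑ b ∈ range (w₀ + 1), Rp 0 b 0 = 2 ^ j
  /-- the quadratic parity count -/
  quad : (2 * ((∑ a ∈ (range (n - w₀ + 1)).filter Even, ∑ b ∈ range (w₀ + 1), ∑ c ∈ range (w₀ + 1), R a b c : ℕ) : ℤ)
      - 2 ^ (n - k)) ^ 2 = 0 ∨
    ∃ j : ℕ, (2 * ((∑ a ∈ (range (n - w₀ + 1)).filter Even, ∑ b ∈ range (w₀ + 1), ∑ c ∈ range (w₀ + 1),
      R a b c : ℕ) : ℤ) - 2 ^ (n - k)) ^ 2 = 2 ^ j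
  /-- the splits on the path hold -/
  path : ∀ s ∈ path, s.Holds n w₀ A B W R Rp

/-- `get3 [] = 0`. [folklore] -/
private theorem get3_nil (a b c : ℕ) : get3 [] a b c = 0 := by simp [get3]

/-- The form of a path row with only an `R`-table. [folklore] -/
theorem form_crOnly (cr : List (List (List ℤ))) (v : ℤ) (g : Bool) :
    (⟨[], [], [], cr, [], v, g⟩ : RSplit).form n w₀ A B W R Rp =
      boxSum n w₀ (fun a b c => get3 cr a b c * (R a b c : ℤ)) := by
  simp [RSplit.form, get3_nil, boxSum]

/-- The form of a path row with only an `R′`-table. [folklore] -/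
theorem form_crpOnly (crp : List (List (List ℤ))) (v : ℤ) (g : Bool) :
    (⟨[], [], [], [], crp, v, g⟩ : RSplit).form n w₀ A B W R Rp =
      boxSum n w₀ (fun a b c => get3 crp a b c * (Rp a b c : ℤ)) := by
  simp [RSplit.form, get3_nil, boxSum]

/-- `K` as the box sum of its table. [folklore] -/
theorem boxSum_tabKC (X : ℕ → ℕ → ℕ → ℕ) :
    boxSum n w₀ (fun a b c => get3 (tabKC (n - w₀) w₀) a b c * (X a b c : ℤ)) =
      ((∑ a ∈ range (n - w₀ + 1), ∑ b ∈ range (w₀ + 1), X a b 0 : ℕ) : ℤ) := by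
  unfold boxSum tabKC
  push_cast
  refine Finset.sum_congr rfl fun a ha => Finset.sum_congr rfl fun b hb => ?_
  rw [Finset.sum_congr rfl fun c hc => by
    rw [get3_tab3 _ _ _ (Nat.lt_succ_iff.1 (mem_range.1 ha)) (Nat.lt_succ_iff.1 (mem_range.1 hb))
      (Nat.lt_succ_iff.1 (mem_range.1 hc)), ite_mul, one_mul, zero_mul]]
  rw [Finset.sum_ite_eq' (range (w₀ + 1)) 0 (fun c => (X a b c : ℤ)), if_pos (by simp)]

/-- `K′` as the box sum of its table. [folklore] -/
theorem boxSum_tabKD (X : ℕ → ℕ → ℕ → ℕ) :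
    boxSum n w₀ (fun a b c => get3 (tabKD (n - w₀) w₀) a b c * (X a b c : ℤ)) =
      ((∑ b ∈ range (w₀ + 1), X 0 b 0 : ℕ) : ℤ) := by
  unfold boxSum tabKD
  push_cast
  rw [Finset.sum_eq_single_of_mem 0 (mem_range.2 (Nat.succ_pos _))]
  · refine Finset.sum_congr rfl fun b hb => ?_
    rw [Finset.sum_congr rfl fun c hc => by
      rw [get3_tab3 _ _ _ (Nat.zero_le _) (Nat.lt_succ_iff.1 (mem_range.1 hb)) (Nat.lt_succ_iff.1 (mem_range.1 hc)),
        ite_mul, one_mul, zero_mul]]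
    simp only [true_and]
    rw [Finset.sum_ite_eq' (range (w₀ + 1)) 0 (fun c => (X 0 b c : ℤ)), if_pos (by simp)]
  · intro a ha ha0
    refine Finset.sum_eq_zero fun b hb => Finset.sum_eq_zero fun c hc => ?_
    rw [get3_tab3 _ _ _ (Nat.lt_succ_iff.1 (mem_range.1 ha)) (Nat.lt_succ_iff.1 (mem_range.1 hb))
      (Nat.lt_succ_iff.1 (mem_range.1 hc))]
    simp [ha0]

/-- `Z` as the box sum of its table. [folklore] -/
theorem boxSum_tabZ (X : ℕ → ℕ → ℕ → ℕ) :
    boxSum n w₀ (fun a b c => get3 (tabZ (n - w₀) w₀) a b c * (X a b c : ℤ)) =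
      ((∑ a ∈ (range (n - w₀ + 1)).filter Even, ∑ b ∈ range (w₀ + 1), ∑ c ∈ range (w₀ + 1), X a b c : ℕ) : ℤ) := by
  unfold boxSum tabZ
  push_cast
  rw [Finset.sum_filter]
  refine Finset.sum_congr rfl fun a ha => ?_
  rw [Finset.sum_congr rfl fun b hb => Finset.sum_congr rfl fun c hc => by
    rw [get3_tab3 _ _ _ (Nat.lt_succ_iff.1 (mem_range.1 ha)) (Nat.lt_succ_iff.1 (mem_range.1 hb))
      (Nat.lt_succ_iff.1 (mem_range.1 hc))]]
  split_ifs with hev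
  · simp
  · simp

/-- A gap is respected by every admissible value: if `x ≤ v ∨ v′ ≤ x` then one of the two path rows
`⟨…, v, false⟩` (`form ≤ v`) / `⟨…, v′ − 1, true⟩` (`form ≥ v′`) holds, for a form carried by an `R`-table.
[folklore] -/
theorem gap_holds_cr (cr : List (List (List ℤ))) {v v' : ℤ}
    (hx : boxSum n w₀ (fun a b c => get3 cr a b c * (R a b c : ℤ)) ≤ v ∨
      v' ≤ boxSum n w₀ (fun a b c => get3 cr a b c * (R a b c : ℤ))) :
    (⟨[], [], [], cr, [], v, false⟩ : RSplit).Holds n w₀ A B W R Rp ∨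
      (⟨[], [], [], cr, [], v' - 1, true⟩ : RSplit).Holds n w₀ A B W R Rp := by
  rcases hx with hx | hx
  · left
    simp only [RSplit.Holds, RSplit.rhs, RSplit.sgn, Bool.false_eq_true, ↓reduceIte, form_crOnly]
    linarith
  · right
    simp only [RSplit.Holds, RSplit.rhs, RSplit.sgn, ↓reduceIte, form_crOnly]
    linarith

/-- The same for a form carried by an `R′`-table. [folklore] -/
theorem gap_holds_crp (crp : List (List (List ℤ))) {v v' : ℤ}
    (hx : boxSum n w₀ (fun a b c => get3 crp a b c * (Rp a b c : ℤ)) ≤ v ∨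
      v' ≤ boxSum n w₀ (fun a b c => get3 crp a b c * (Rp a b c : ℤ))) :
    (⟨[], [], [], [], crp, v, false⟩ : RSplit).Holds n w₀ A B W R Rp ∨
      (⟨[], [], [], [], crp, v' - 1, true⟩ : RSplit).Holds n w₀ A B W R Rp := by
  rcases hx with hx | hx
  · left
    simp only [RSplit.Holds, RSplit.rhs, RSplit.sgn, Bool.false_eq_true, ↓reduceIte, form_crpOnly]
    linarith
  · right
    simp only [RSplit.Holds, RSplit.rhs, RSplit.sgn, ↓reduceIte, form_crpOnly]
    linarith

/-- A power of two respects a `pow2GapOK` gap. [folklore] -/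
theorem pow2_gap {J : ℕ} {v v' : ℤ} (h : pow2GapOK J v v' = true) (j : ℕ) :
    (2 : ℤ) ^ j ≤ v ∨ v' ≤ (2 : ℤ) ^ j := by
  simp only [pow2GapOK, Bool.and_eq_true, List.all_eq_true, List.mem_range, decide_eq_true_eq] at h
  obtain ⟨hall, hJ⟩ := h
  by_cases hj : j < J
  · exact hall j hj
  · right
    calc v' ≤ (2 : ℤ) ^ J := hJ
      _ ≤ (2 : ℤ) ^ j := pow_le_pow_right₀ (by norm_num) (by omega)

/-- An admissible quadratic count respects a `quadGapOK` gap. [cite: MacWilliamsSloane1977, Ch. 15 §2 Thm. 5] -/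
theorem quad_gap {N J : ℕ} {v v' : ℤ} (h : quadGapOK N J v v' = true) {Z : ℤ}
    (hZ : (2 * Z - 2 ^ N) ^ 2 = 0 ∨ ∃ j : ℕ, (2 * Z - 2 ^ N) ^ 2 = 2 ^ j) : Z ≤ v ∨ v' ≤ Z := by
  by_contra hcon
  push Not at hcon
  obtain ⟨h1, h2⟩ := hcon
  simp only [quadGapOK, Bool.and_eq_true, List.all_eq_true, List.mem_range, decide_eq_true_eq] at h
  have ht : (Z - v - 1).toNat < (v' - v - 1).toNat := by
    have : Z - v - 1 < v' - v - 1 := by linarith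
    exact (Int.toNat_lt_toNat (by linarith)).2 this
  obtain ⟨⟨hne, hlt⟩, hall⟩ := h _ ht
  have hz : v + 1 + (((Z - v - 1).toNat : ℕ) : ℤ) = Z := by
    rw [Int.toNat_of_nonneg (by linarith)]; ring
  rw [hz] at hne hlt hall
  rcases hZ with h0 | ⟨j, hj⟩
  · exact hne h0
  · by_cases hjJ : j < J
    · exact hall j hjJ hj
    · have : (2 : ℤ) ^ J ≤ (2 : ℤ) ^ j := pow_le_pow_right₀ (by norm_num) (by omega)
      rw [hj] at hlt
      linarith

/-- Extending the path of a `LeafHypQ` by a row that holds. [folklore] -/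
theorem LeafHypQ.snoc {path : List RSplit} (H : LeafHypQ n k d e w₀ path A B W R Rp Rpp) {s : RSplit}
    (hs : s.Holds n w₀ A B W R Rp) : LeafHypQ n k d e w₀ (path ++ [s]) A B W R Rp Rpp :=
  ⟨H.sys, H.ref, H.ref2, H.link, H.kc, H.kd, H.quad, fun s' hs' => by
    rcases List.mem_append.1 hs' with hs' | hs'
    · exact H.path s' hs'
    · rw [List.mem_singleton.1 hs']; exact hs⟩

/-- **Soundness of the quad tree checker**: leaves by weak duality (`not_leafHypP_of_rleafOKP`), integer splits by
integrality, gap splits by the three facts and their decided side conditions. Column: proved (ours).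
[cite: MacWilliamsSloane1977, Ch. 15 §2 Thm. 5 and Ch. 17 §4 Thm. 20] -/
theorem not_leafHypQ_of_checkPathQ (t : RTreeQ) {path : List RSplit} (h : t.checkPathQ n k d e w₀ path = true)
    (H : LeafHypQ n k d e w₀ path A B W R Rp Rpp) : False := by
  induction t generalizing path with
  | leaf L => exact not_leafHypP_of_rleafOKP h ⟨H.sys, H.ref, H.ref2, H.link, H.path⟩
  | split ca cb cw cr crp v le ge ihl ihg =>
    simp only [RTreeQ.checkPathQ, Bool.and_eq_true] at h
    rcases rsplit_holds_or n w₀ ca cb cw cr crp v A B W R Rp with hl | hg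
    · exact ihl h.1 (H.snoc hl)
    · exact ihg h.2 (H.snoc hg)
  | gapKC J v v' le ge ihl ihg =>
    simp only [RTreeQ.checkPathQ, Bool.and_eq_true] at h
    obtain ⟨hgap, hle, hge⟩ := h
    obtain ⟨j, hj⟩ := H.kc
    have hx := pow2_gap hgap j
    rw [show ((2 : ℤ) ^ j) = ((2 ^ j : ℕ) : ℤ) by push_cast; ring, ← hj, ← boxSum_tabKC (n := n) (w₀ := w₀) R] at hx
    rcases gap_holds_cr (A := A) (B := B) (W := W) (Rp := Rp) (tabKC (n - w₀) w₀) hx with hl | hg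
    · exact ihl hle (H.snoc hl)
    · exact ihg hge (H.snoc hg)
  | gapKD J v v' le ge ihl ihg =>
    simp only [RTreeQ.checkPathQ, Bool.and_eq_true] at h
    obtain ⟨hgap, hle, hge⟩ := h
    obtain ⟨j, hj⟩ := H.kd
    have hx := pow2_gap hgap j
    rw [show ((2 : ℤ) ^ j) = ((2 ^ j : ℕ) : ℤ) by push_cast; ring, ← hj, ← boxSum_tabKD (n := n) (w₀ := w₀) Rp] at hx
    rcases gap_holds_crp (A := A) (B := B) (W := W) (R := R) (tabKD (n - w₀) w₀) hx with hl | hg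
    · exact ihl hle (H.snoc hl)
    · exact ihg hge (H.snoc hg)
  | gapZ J v v' le ge ihl ihg =>
    simp only [RTreeQ.checkPathQ, Bool.and_eq_true] at h
    obtain ⟨hgap, hle, hge⟩ := h
    have hx := quad_gap hgap H.quad
    rw [← boxSum_tabZ (n := n) (w₀ := w₀) R] at hx
    rcases gap_holds_cr (A := A) (B := B) (W := W) (Rp := Rp) (tabZ (n - w₀) w₀) hx with hl | hg
    · exact ihl hle (H.snoc hl)
    · exact ihg hge (H.snoc hg)

/-- **Two checked quad certificates (one per parity branch) refute the strengthened system** — UNCONDITIONAL.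
Column: proved (ours). [cite: CalderbankEtAl1998, §7 (ii) (printed p. 28); MacWilliamsSloane1977, Ch. 15 §2 Thm. 5] -/
theorem not_crssRefinedQuadFeasible_of_checkQ (t₀ t₁ : RTreeQ) (h₀ : t₀.checkQ n k d 0 w₀ = true)
    (h₁ : t₁.checkQ n k d 1 w₀ = true) : ¬ CRSSRefinedQuadFeasible n k d w₀ := by
  rintro ⟨A, B, W, e, R, Rp, Rpp, hsys, href, href2, hlink, hkc, hkd, hquad⟩
  have he := hsys.1
  interval_cases e
  · exact not_leafHypQ_of_checkPathQ (path := []) t₀ h₀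
      ⟨hsys, href, href2, hlink, hkc, hkd, hquad, fun s hs => by simp at hs⟩
  · exact not_leafHypQ_of_checkPathQ (path := []) t₁ h₁
      ⟨hsys, href, href2, hlink, hkc, hkd, hquad, fun s hs => by simp at hs⟩

end Soundness

/-! ### 3. Assembly: CRSS's two-stage argument with the strengthened refined system -/

/-- **CRSS's two-stage special-bound argument with the strengthened refined system, certified.** Let `zs` be a list
of EVEN weights. If (a) the plain integer system together with `A_w = 0` (`w ∈ zs`) is refuted by checked certificates
in both parity branches and (b) for every `w ∈ zs` the strengthened refined system of the pair `(C, C′)` w.r.t. a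
codeword of weight `w` is infeasible, then there is no `[[n,k,d]]` additive code whose stabilizer space has no word of
weight `1`. Column: proved (ours). [cite: CalderbankEtAl1998, §7 (ii)–(iii) (printed p. 28)] -/
theorem no_additiveCode_of_quadCerts {n k d : ℕ} (zs : List ℕ) (t₀ t₁ : IPTree) (h₀ : t₀.checkZ n k d 0 zs = true)
    (h₁ : t₁.checkZ n k d 1 zs = true) (hev : ∀ w ∈ zs, Even w) (href : ∀ w ∈ zs, ¬ CRSSRefinedQuadFeasible n k d w)
    (S : Submodule (ZMod 2) (SympVec n)) (hS : IsAdditiveCode S k d) (hw1 : ∀ v ∈ S, sympWeight v ≠ 1) : False := by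
  classical
  have hsys := hS.crssIntSystem hw1
  have hz : ∀ w ∈ zs, wtDist S w = 0 := fun w hw =>
    wtDist_eq_zero_of_not_crssRefinedQuadFeasible hS hw1 (hev w hw) (href w hw)
  have he := hsys.1
  rcases Nat.le_one_iff_eq_zero_or_eq_one.1 he with he0 | he1
  · rw [he0] at hsys; exact not_sat_checkZ h₀ hsys hz
  · rw [he1] at hsys; exact not_sat_checkZ h₁ hsys hz

end Summit.Ventures.QEC.Census
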